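import Summits.BirchSwinnertonDyer.Rank1Residual.X2.IsogenyLineType
import Summits.BirchSwinnertonDyer.Rank1Residual.X2.IsogenyQuotientLine
import Summits.BirchSwinnertonDyer.Rank1Residual.X2.GreenbergVatsalReductionDatumLine
import Summits.BirchSwinnertonDyer.Rank1Residual.X2.GreenbergVatsalReductionDatumCard
import HarnessLib

/-!
# GV CASE 2 ⟹ CASE 1 along the quotient isogeny at a GOOD ORDINARY prime: the image of an
# unramified-odd kernel line is a RAMIFIED-EVEN rational line — the local input is Greenberg's
# REDUCTION LINE `C_p[p] = ker(E[p] → Ẽ[p])` (cell `b2b-bsdres`, unit `b2b-bsdres-eisenstein-p2`,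
# gen 20; the printed setting of GV Thm. (1.3), X2-GAP §24.6 3(i))

HONEST FRAMING (run/shared/lean/b2b/bsd-rank1-residual/, verbatim in every file): the goal of the
cell is to DELETE the COMBINATION-SHAPED residual classes of the Birch–Swinnerton-Dyer formula for
ALL analytic-rank `≤ 1` elliptic curves over `ℚ` — "full BSD formula for every rank `≤ 1` curve in
class `C`" assembled STRICTLY from published theorems — so that the rank-`≤ 1` remainder becomes
exactly the CONSTRUCTION-SHAPED classes, which are TYPED (missing-input `Prop`s), NOT attempted.
This is not "finishing BSD". Research route; NO CLAIM BEYOND STATED CLASSES; nothing here changes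
a label (X1's GV-parity cells are COVERED by the PRINTED GV Thm. (1.3); this file is a step of the
kernel RE-DERIVATION of that printed theorem, it books nothing). Theorems only; no definition, no
named fact.

WHY. Gen 18 (`X2/IsogenyLineType`) performed Greenberg–Vatsal's reduction of CASE 2 of the parity
hypothesis (rational line `Φ₀` UNRAMIFIED at `p` and ODD) to CASE 1 (line RAMIFIED and EVEN) along
the `p`-isogeny `E → E' = E/Φ₀` (GV p. 28) at a MULTIPLICATIVE prime, where the local input (hL₀)
was the TATE LINE. Its Galois-module core `isRationalLine_range_and_ramified_even_of_ker` is
reduction-type free: it needs, at ONE prime `𝔓 ∣ p`, a line `L ≤ E[p]` with `(σ − 1)E[p] ⊆ L` for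
`σ ∈ I_𝔓` and a point of `L` moved by `I_𝔓`. At a GOOD ORDINARY prime this line is Greenberg's
REDUCTION LINE `C_p[p]`, `C_p = ker(E[p^∞] → Ẽ(𝔽̄_p))`: `I_p` acts trivially on `E[p^∞]/C_p` (gen 9
`reductionData_htriv`), `I_p` moves every point of `C_p[p] ≅ μ_p` (gen 9
`reductionData_hgen`, via the Weil pairing and local Kronecker–Weber), `#C_p[p] = p` (gen 19
`natCard_reductionData_plus_inf_torsionBy`, ordinarity). So:

* §1 `exists_reductionLine_adicCompletionPrime` — (hL₀) at an odd good ordinary prime;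
* §2 `exists_rationalLine_ramified_even_of_isogeny_goodOrd` — `E` CASE 2 ⟹ `E/Φ₀` CASE 1 at a
  good ordinary prime (signs of complex conjugation by the Weil pairing, as in gen 18);
* §3 transport along a `ℚ`-isogeny of the standing data at a good ordinary prime: good reduction
  (Serre–Tate, tree `IsIsogenous.hasGoodReductionAtPrime_iff`), `a_p` (Faltings, tree
  `frobeniusTrace_eq_of_isIsogenous`), hence ordinarity and THE SAME unit root
  `unitRoot W p = unitRoot W' p` of `X² − a_p X + p` (so the Mazur–Swinnerton-Dyer `p`-adic
  `L`-functions `padicLFunction f α` of `E` and `E'` are built from the same `(f, α)`).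

References: [GreenbergVatsal2000] §2 p. 28 (reduction to `φ` ramified and even), p. 26
("`C[p] = μ_p`"); [GreenbergLNM1716] §2 p. 70; HOME/b2b-bsdres-eisenstein-p2/X2-GAP.md §23, §25.
-/

set_option autoImplicit false

noncomputable section

open scoped Classical AddSubgroup

open WeierstrassCurve Literature.NumberTheory.EllipticCurves Literature.NumberTheory.GaloisRepresentations
  Field IsDedekindDomain NumberField
  Literature.NumberTheory.EllipticCurves.GreenbergSelmer
  Literature.NumberTheory.EllipticCurves.Rank1Residual
  Summit.BirchSwinnertonDyer.Rank1Residual.X2.GreenbergVatsalTorsion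
  Summit.BirchSwinnertonDyer.Rank1Residual.X2.GreenbergVatsalReductionDatum
  Summit.BirchSwinnertonDyer.Rank1Residual.X2.GreenbergVatsalReductionDatumLine
  Summit.BirchSwinnertonDyer.Rank1Residual.X2.IsogenyLineType

namespace Summit.BirchSwinnertonDyer.Rank1Residual.X2.IsogenyLineTypeGoodOrdinary

variable {W W' : WeierstrassCurve ℚ} {p : ℕ} [hp : Fact p.Prime]

/-! ## §1. The reduction line at an odd good ordinary prime, in `𝔓.inertia` form (hL₀) -/

section ReductionLine

variable (W p) [W.IsElliptic] [W.IsGloballyMinimal]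

/-- **(hL₀) at an odd GOOD ORDINARY prime** (Greenberg's REDUCTION LINE): for `E/ℚ` globally
minimal with good ordinary reduction at the odd prime `p`, at the place `v` of `ℚ` above `p` and
the prime `𝔓₀ = adicCompletionPrime ℚ v` of `\bar ℤ` there is a line `L ≤ E[p]` (`L = C_p[p]`,
`C_p = ker(E[p^∞] → Ẽ)`) of order `p` with `(σ − 1)E[p] ⊆ L` for all `σ ∈ I_{𝔓₀}` (the quotient
`Ẽ[p]` is unramified) and some `σ ∈ I_{𝔓₀}` moving a point of `L` (`C_p[p] ≅ μ_p` as an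
`I_p`-module and `p` is odd — GV p. 26: "the subgroup `C[p]` of `A[p]` is determined by the action
of `I_p`: `C[p] = μ_p`"). Inputs: gen 9's reduction datum (`reductionData_htriv`), gen 9's
`reductionData_hgen`, gen 19's `#C_p[p] = p` (`natCard_reductionData_plus_inf_torsionBy`), read at
`𝔓₀` by gen 18's `exists_line_adicCompletionPrime_of_datum`. No named fact.
[cite: GreenbergVatsal2000, §2 p. 26 and p. 28] [cite: GreenbergLNM1716, §2 p. 70] -/
theorem exists_reductionLine_adicCompletionPrime (hp2 : p ≠ 2)
    (hgood : W.HasGoodReductionAtPrime p) (hord : ¬ (p : ℤ) ∣ W.frobeniusTrace p) :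
    ∃ (v : HeightOneSpectrum (𝓞 ℚ)), (p : 𝓞 ℚ) ∈ v.asIdeal ∧ ∃ 𝔓 ∈ v.primesAbove,
      ∃ L : AddSubgroup (geomTorsion W (p : ℤ)), Nat.card L = p ∧
        (∀ σ ∈ 𝔓.inertia (absoluteGaloisGroup ℚ), ∀ P : geomTorsion W (p : ℤ), σ • P - P ∈ L) ∧
        (∃ σ ∈ 𝔓.inertia (absoluteGaloisGroup ℚ), ∃ P ∈ L, σ • P ≠ P) := by
  have hpP : p.Prime := hp.out
  have hΔ : ¬ (p : ℤ) ∣ minimalDiscriminantInt W :=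
    W.not_dvd_minimalDiscriminantInt_of_hasGoodReductionAtPrime' p hgood
  obtain ⟨v, hv⟩ :=
    Literature.NumberTheory.NumberFields.RingOfIntegers.exists_heightOneSpectrum_natCast_mem ℚ hpP
  refine ⟨v, hv, adicCompletionPrime ℚ v, adicCompletionPrime_mem_primesAbove ℚ v, ?_⟩
  exact exists_line_adicCompletionPrime_of_datum W p hv (reductionData W p hΔ v hv)
    (reductionData_htriv W p hΔ v hv) (reductionData_hgen W p hp2 hΔ hord v hv)
    (natCard_reductionData_plus_inf_torsionBy W p hΔ hord v hv)

end ReductionLine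

/-! ## §2. CASE 2 for `E` gives CASE 1 for `E/Φ₀` at a good ordinary prime -/

section Assembly

variable [W.IsElliptic] [W.IsGloballyMinimal]

/-- **GV CASE 2 for `E` ⟹ CASE 1 for `E' = E/Φ₀`, at a GOOD ORDINARY prime.** Let `E/ℚ` be
globally minimal with good ordinary reduction at the odd prime `p`, `Φ₀ ≤ E[p]` a rational line
UNRAMIFIED at `p` and ODD, and `g : E → E'` a `ℚ`-isogeny whose kernel on `ℚ̄`-points is `Φ₀`.
Then `E'[p]` contains a rational line (namely `g(E[p]) ≅ E[p]/Φ₀`) which is RAMIFIED at `p` and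
EVEN — gen 18's Galois-module theorem `isRationalLine_range_and_ramified_even_of_ker` fed with the
reduction line of §1 instead of the Tate line; the signs of complex conjugation come from the Weil
pairing (`exists_fixed_and_antifixed_of_isComplexConjugation`). GV p. 28: "we may assume … `φ` is
ramified and even" — here in the paper's own (good ordinary) setting. No named fact.
[cite: GreenbergVatsal2000, §2 p. 28 (reduction to φ ramified and even)] -/
theorem exists_rationalLine_ramified_even_of_isogeny_goodOrd (hp2 : p ≠ 2)
    (hgood : W.HasGoodReductionAtPrime p) (hord : ¬ (p : ℤ) ∣ W.frobeniusTrace p)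
    {Φ₀ : AddSubgroup (geomTorsion W (p : ℤ))} (hΦ : IsRationalLine W p Φ₀)
    (hu : LineUnramifiedAt W p Φ₀) (ho : LineOdd W p Φ₀)
    (f : Isogeny W W') (hker : f.toAddMonoidHom.ker = Φ₀.map (geomTorsion W (p : ℤ)).subtype) :
    ∃ Φ' : AddSubgroup (geomTorsion W' (p : ℤ)),
      IsRationalLine W' p Φ' ∧ ¬ LineUnramifiedAt W' p Φ' ∧ LineEven W' p Φ' := by
  obtain ⟨g, hgval, hg⟩ := exists_restrict_torsion (p := p) f
  -- `ker g = Φ₀`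
  have hK : g.ker = Φ₀ := by
    ext P
    rw [AddMonoidHom.mem_ker]
    constructor
    · intro hP
      have h1 : (P : geomPoints W) ∈ f.toAddMonoidHom.ker := by
        rw [AddMonoidHom.mem_ker, Isogeny.coe_toAddMonoidHom, ← hgval, hP]; rfl
      rw [hker] at h1
      obtain ⟨Q, hQ, hQP⟩ := h1
      have : Q = P := Subtype.ext hQP
      exact this ▸ hQ
    · intro hP
      have h1 : (P : geomPoints W) ∈ f.toAddMonoidHom.ker := by
        rw [hker]; exact ⟨P, hP, rfl⟩
      rw [AddMonoidHom.mem_ker, Isogeny.coe_toAddMonoidHom, ← hgval] at h1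
      exact Subtype.ext h1
  have hKcard : Nat.card g.ker = p := by rw [hK]; exact hΦ.1
  obtain ⟨hline, hram, heven⟩ := isRationalLine_range_and_ramified_even_of_ker g hg hp2
    (Rank1Residual.natCard_geomTorsion W p)
    (exists_reductionLine_adicCompletionPrime W p hp2 hgood hord)
    (exists_fixed_and_antifixed_of_isComplexConjugation W hp2) hKcard (hK ▸ hu) (hK ▸ ho)
  exact ⟨g.range, hline, hram, heven⟩

end Assembly

/-! ## §3. Transport of the good-ordinary data along a `ℚ`-isogeny -/

section Transport

variable [W.IsElliptic] [W'.IsElliptic] [W.IsGloballyMinimal] [W'.IsGloballyMinimal]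

omit [W.IsGloballyMinimal] [W'.IsGloballyMinimal] in
/-- Good reduction at `p` passes along a `ℚ`-isogeny (Serre–Tate / *AEC* Cor. VII.7.2, tree
`IsIsogenous.hasGoodReductionAtPrime_iff`). [cite: SilvermanAEC2009, Cor. VII.7.2] -/
theorem hasGoodReductionAtPrime_of_isIsogenous (h : IsIsogenous W W')
    (hgood : W.HasGoodReductionAtPrime p) : W'.HasGoodReductionAtPrime p :=
  (h.hasGoodReductionAtPrime_iff p).mp hgood

/-- Ordinarity `p ∤ a_p` passes along a `ℚ`-isogeny: `a_p(E) = a_p(E')` at a common good prime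
(Faltings; tree `frobeniusTrace_eq_of_isIsogenous`). [cite: Faltings1983Endlichkeit, §5 Korollar 2] -/
theorem not_dvd_frobeniusTrace_of_isIsogenous (h : IsIsogenous W W')
    (hgood : W.HasGoodReductionAtPrime p) (hord : ¬ (p : ℤ) ∣ W.frobeniusTrace p) :
    ¬ (p : ℤ) ∣ W'.frobeniusTrace p := by
  rwa [← frobeniusTrace_eq_of_isIsogenous h p hgood (hasGoodReductionAtPrime_of_isIsogenous h hgood)]

/-- **The unit root is an isogeny invariant**: `unitRoot W p` is defined from `a_p(W)` alone (the
unit root of `X² − a_p X + p`), and `a_p(W) = a_p(W')` for `ℚ`-isogenous globally minimal curves at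
a common good prime — so the Mazur–Swinnerton-Dyer `p`-adic `L`-functions of `E` and `E'`,
`padicLFunction f (unitRoot · p)` for the common newform `f`, coincide.
[cite: Faltings1983Endlichkeit, §5 Korollar 2] -/
theorem unitRoot_eq_of_isIsogenous (h : IsIsogenous W W') (hgood : W.HasGoodReductionAtPrime p) :
    unitRoot W p = unitRoot W' p := by
  unfold unitRoot
  rw [frobeniusTrace_eq_of_isIsogenous h p hgood (hasGoodReductionAtPrime_of_isIsogenous h hgood)]

end Transport

end Summit.BirchSwinnertonDyer.Rank1Residual.X2.IsogenyLineTypeGoodOrdinary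

end
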